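import Literature.MathematicalPhysics.QuantumFieldTheory.Balaban1983to89.B9Eq3152ThirdWordPiTwoBackgroundLetterTower
import Literature.MathematicalPhysics.QuantumFieldTheory.Balaban1983to89.B9Eq3153FrakGkPiMiddleWordTwoBackgroundLetterTower

/-!
# `Balaban1983to89.B9Eq3153FrakGkPiTwoBackgroundLetterTower` — T. Bałaban, *Propagators for lattice gauge theories in a background field*, Commun. Math. Phys. **99** (1985) 389–434
# [Balaban1985BackgroundPropagators] (3.153) p. 426 *«the operator G₁𝔓\* is equal to the operator 𝔊»* ∕ (3.147) p. 425, (3.122) p. 420, (3.126) p. 420, Thm 3.4 p. 400, Thm 3.13 p. 426, with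
# [Balaban1985Variational] (110)–(111) p. 294 (*«𝔊 = G − GQ\*(QGQ\*)⁻¹QG − GDRD\*G»*), (117) p. 295: **THE `𝔊̃_k` STOREY OF ROUTE (J′) — PRINT's `𝔊̃_k = G̃_k − H̃_kQ_kG̃_k − G̃_kD_UR_kD*_UG̃_k`
# (operator (3.122)) AGAINST THE CHAIN's `𝔊_k(1)` AT THE FLAT BASE, VALUE MEMBER, LATTICE-FREE** — for one-block fine-bond sources `f` over the coarse block `v` with `‖f‖_∞ ≤ F`:
# `‖((𝔊̃_k(U) − 𝔊_k(1))f)(b)‖ ≤ (j₀ + α)·K·e^{−κ·d_m(Π(b₋), v)}·F`, and the GLOBAL sup row `‖((𝔊̃_k(U) − 𝔊_k(1))g)(b)‖ ≤ (j₀ + α)·K′·‖g‖_∞` for EVERY `g`, constants BEFORE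
# `n, η, m, U` — the three words of gen 101∕102: `B9Eq3130GtildeTwoBackgroundLetterTower` (first), `B9Eq3153FrakGkPiMiddleWordTwoBackgroundLetterTower` (middle),
# `B9Eq3152ThirdWordPiTwoBackgroundLetterTower` (third), summed; `𝔊̃_k(1) = 𝔊_k(1)` (`B9Eq3119DeltaPiTowerFlat`), so this IS the two-background ladder of the `𝔊`-letter of the chart the
# cell instantiates (the `M_T` datum of the OWNER's (117) socket `B11Eq117TransformationNormComp.norm_toCLM115_le_of_comp` for `T := 𝔊̃_k(U) − 𝔊_k(1)`)

statement-level skeleton of published theorems with citation tags; proofs where landed; nothing here is a claim about the Yang–Mills mass gap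

CITATION HEADER (lean-in-tree rule).  Audit cell `pub-balaban`, sub-cell `t4`, BINDER row NE9; filed by NE9 crux-team LEAF PROVER 01 (`b2b-balaban-t4-ne9-formalise-leaf-01`, gen 102;
ROUTE (J′), π-side, the `𝔊̃` storey (assembly); bears_on: R4/N22).  Composition BY NAME: gen 101's `B9Eq3130GtildeTwoBackgroundLetterTower.exists_letters_G1kPi_sub_flat` (conjunct 1),
`B9Eq3153FrakGkPiMiddleWordTwoBackgroundLetterTower.exists_letter_middleWordPi_sub_flat`; this generation's `B9Eq3152ThirdWordPiTwoBackgroundLetterTower.exists_letter_thirdWordPi_sub_flat`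
(MODEL rows under it — O-NE9-1, #5 UNRULED); the OWNER's `B11Eq103H1Complex.{frakGLatticeK, H1LatticeK_eq}`, lit-balaban's `B11Eq111FrakG.frakGLin_apply`; ne9-leaf-01's
`B9Eq349BlockMultipliers.{exists_block_clm_family, sum_block_apply}` (the block decomposition of the source, pattern of gen 101's `B9Eq3133H1kPiTwoBackgroundSupRowsTower`).  Source READ
first-hand in the held text layer `paper:balaban1985-cmp99-background-propagators` (journal page = PDF page + 388) pp. 400, 420, 425–426; `paper:balaban1985-cmp98-averaging` p. 295.  NOTHING of
print's proofs is reproduced: [folklore] a three-term difference and a block sum.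

WHAT IS PROVED (sorry-free; proof lane — 0 `def`; [folklore]).
* §1 **`exists_letter_frakGkPi_sub_flat`** — `∃ α₁ j₁ > 0, K ≥ 0, κ > 0` BEFORE the binder block of `exists_letters_G1kPi_sub_flat` `+ hQ1` (the onto-witness of `Q_k(1)`, displayed as in gen 101's
  `B11Eq117H1kPiLetterDefectAtFlatLatticeFree`): `‖((frakGLatticeK hposπ hQ) f − (frakGLatticeK …(flat data)… hpos₁ hQ1) f)(b)‖ ≤ (j₀ + α)·K·e^{−κ·d_m(Π(b₋),v)}·F`.
* §2 **`exists_supRow_frakGkPi_sub_flat`** — `∃ α₁ j₁ > 0, K ≥ 0` BEFORE the same block: for EVERY fine-bond field `g` with `‖g(b′)‖ ≤ M`, `‖((𝔊̃_k(U) − 𝔊_k(1))g)(b)‖ ≤ (j₀ + α)·K·M`.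
HONEST SCOPE.  Composition BY NAME on the cell's MODEL rows (O-NE9-1, #5 UNRULED); constants crude (NOT print's `B₀`); VALUE member only: the GRADIENT member `∇_1(𝔊̃_k(U) − 𝔊_k(1))` — the
`M_{∇T}` datum of the (117) socket, hence the lattice-free `δ̃_G` — needs, for the third word, η-scale Hölder ∕ Hessian rows of `G′_k` BETWEEN TWO BACKGROUNDS (Thm 3.4 for (3.43)₂∕(3.44)), NOT
in the tree (LOCATED by this generation; the first and middle words' gradient letters exist: `exists_letters_G1kPi_sub_flat` conjunct 3, `exists_gradLetter_middleWordPi_sub_flat`); `j₀`, `α`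
displayed separately; the windows, `c₀ = η^d`, unitarity, the tower data, `hαL`, the positivity and onto witnesses stay HYPOTHESES; nothing of [B9] (3.153) ∕ Thm 3.4 ∕ 3.13 or [B11] (117)
asserted as printed; «NE9 ⇐ the named binders»; NE9 NOT PRINTED ∕ NOT PROVED; spine PROVED 0∕9; rung (B)+1 on a finite T⁴ — NOT infinite volume, NOT mass gap, NOT BetaPertH, NOT Clay.  HONEST
DEPENDENCY: continuum YM on T⁴ ⇐ BetaPertH ∧ nine spine estimates (0/9 proved); BetaPertH ⇐ (D1) ∧ (D4) ∧ CAP+tail; G-an2-4 gates asym, D1 and NE2/3/4.  NEW file; nothing modified.  Net new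
unproved facts: 0.
-/

noncomputable section

open scoped InnerProductSpace ComplexConjugate BigOperators

namespace Literature.MathematicalPhysics.QuantumFieldTheory.Balaban1983to89.B9Eq3153FrakGkPiTwoBackgroundLetterTower

open B4Sect5Torus (TSite tdist tdist_nonneg torusSum_le)
open B4Sect5Proof (latticeConst latticeConst_nonneg)
open B9SectCLatticeCarrier (Bond bpos btgt shift unshift)
open B9Eq311L2Pairing (WL2)
open B9Eq319QprimeTorus (blockCoord)
open B7Prop1Explicit (U1 Wcx boxVec)
open B11Eq103H1Complex (SiteL2K BondL2K covDerivL2K covDivL2K G1LatticeK H1LatticeK H1LatticeK_eq frakGLatticeK)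
open B9Eq310DeltaPrime (plaqHolU)
open B9Eq310HessianOperator (adTransportW hessOp)
open B9Eq315QTorus (perCfg cornerSite)
open B9Eq315QTower (towerP UlevOf)
open B9Eq315QTowerFlat (perCfg_UlevOf_one_mem_U1 norm_Wcx_UlevOf_one_sub_one_le)
open B9Eq316TowerFlatIsOneStep (towerP_eq_fineP_pow siteCast)
open B9Eq326OperatorTower (QkW laplaceAk G1k H1k RofUk)
open B9Eq324DeltaPrimeATower (laplacePrimeAk)
open B9Eq3119DeltaPiTower (laplaceAkPi)
open B11Eq111FrakG (frakGLin_apply)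
open B9Eq349BlockMultipliers (exists_block_clm_family sum_block_apply)
open B9Eq3130GtildeTwoBackgroundLetterTower (exists_letters_G1kPi_sub_flat)
open B9Eq3153FrakGkPiMiddleWordTwoBackgroundLetterTower (exists_letter_middleWordPi_sub_flat)
open B9Eq3152ThirdWordPiTwoBackgroundLetterTower (exists_letter_thirdWordPi_sub_flat)

variable {d : ℕ} (hd : 1 ≤ d) (L : ℕ) [NeZero L] (hL : 1 ≤ L) (hL3 : 3 ≤ L)
  {𝔸 : Type*} [NormedRing 𝔸] [NormedAlgebra ℂ 𝔸] [CompleteSpace 𝔸] [NormOneClass 𝔸] [StarRing 𝔸] [NormedStarGroup 𝔸] [StarModule ℂ 𝔸] [FiniteDimensional ℂ 𝔸]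
  {W : Type*} [NormedAddCommGroup W] [InnerProductSpace ℂ W] [FiniteDimensional ℂ W] (φ : W ≃ₗ[ℂ] 𝔸)
  {Mφ Mφ' : ℝ} (hMφ : 0 ≤ Mφ) (hMφ' : 0 ≤ Mφ') (hφ : ∀ w, ‖φ w‖ ≤ Mφ * ‖w‖) (hφ' : ∀ X, ‖φ.symm X‖ ≤ Mφ' * ‖X‖) (hstar : ∀ X : 𝔸, ‖star X‖ ≤ ‖X‖)
  {a : ℝ} (ha : 0 < a) {a' : ℝ} (ha' : 0 < a') {ϱ : ℝ} (hϱ0 : 0 ≤ ϱ) (hϱ1 : ϱ < 1)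
  (τ : 𝔸 →ₗ[ℂ] ℂ) {Cτ : ℝ} (hτ : ∀ X, ‖τ X‖ ≤ Cτ * ‖X‖) (hCτ : 0 ≤ Cτ) {Mτ : ℝ} (hτm : ∀ X Y : 𝔸, ‖τ (X * Y)‖ ≤ Mτ * ‖X‖ * ‖Y‖) (hMτ : 0 ≤ Mτ)
  {ρw : ℝ} (hρw : 0 ≤ ρw)
  (hτ₁ : ∀ X : 𝔸, τ (star X) = conj (τ X)) (hτ₂ : ∀ X Y : 𝔸, τ (X * Y) = τ (Y * X)) (hφτ : ∀ X Y : 𝔸, ⟪φ.symm X, φ.symm Y⟫_ℂ = τ (star X * Y))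
  (AQ : ℝ)
  {ι : Type} [Fintype ι] [DecidableEq ι] (b : Module.Basis ι ℝ 𝔸) {M₂ : ℝ} (hM₂ : 0 ≤ M₂) (hrepr : ∀ (v : 𝔸) (i : ι), |b.repr v i| ≤ M₂ * ‖v‖)

/-! ## §1 The local letter of `𝔊̃_k(U) − 𝔊_k(1)`, value member -/

include hd hL hL3 hMφ hMφ' hφ hφ' hstar ha ha' hϱ0 hϱ1 hτ hCτ hτm hMτ hρw hτ₁ hτ₂ hφτ hM₂ hrepr in
set_option maxHeartbeats 3200000 in
set_option maxRecDepth 8192 in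
/-- **THE `𝔊̃_k` STOREY, VALUE MEMBER, LOCAL LETTER** — see the module docstring. [folklore]
[cite: Balaban1985BackgroundPropagators, (3.153) p.426, (3.147) p.425, (3.122) p.420, (3.126) p.420, Thm 3.4 p.400, Thm 3.13 p.426; Balaban1985Variational, (110)–(111) p.294, (117) p.295] -/
theorem exists_letter_frakGkPi_sub_flat :
    ∃ α₁ j₁ K κ : ℝ, 0 < α₁ ∧ 0 < j₁ ∧ 0 ≤ K ∧ 0 < κ ∧
      ∀ (n : ℕ) (η : ℝ) (_hηL : η * (L : ℝ) ^ (n + 1) = 1) (c₀ c₁ : ℝ) [Fact (0 < c₀)] [Fact (0 < c₁)]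
        (_hw : c₀ * ((L : ℝ) ^ (n + 1)) ^ d = c₁) (_hρ : |η| ^ d / c₀ ≤ ρw) (m : Fin d → ℕ) [∀ i, NeZero (m i)] (_hm : ∀ i, 1 ≤ m i)
        (U : Bond d (towerP L m (n + 1)) → 𝔸ˣ) (αU : ℕ → ℝ) (_hα0 : ∀ j, 0 ≤ αU j) (hα1 : ∀ j, αU j ≤ 1 / 64)
        (_hαL : ∀ j, 50 * (d + 1) * αU j * (L : ℝ) ^ d ≤ 1 / 2)
        (hU1 : ∀ (j : ℕ) (x : B7Prop1Explicit.Site d) (k : Fin d), perCfg (towerP L m (j + 1)) (UlevOf L m (n + 1) U j) x k ∈ U1 𝔸)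
        (hreg : ∀ (j : ℕ) (y : TSite d (towerP L m j)) (k : Fin d) (ρ' : Fin d → Fin L),
          ‖((Wcx L (perCfg (towerP L m (j + 1)) (UlevOf L m (n + 1) U j)) (cornerSite L y) k (boxVec L ρ') : 𝔸ˣ) : 𝔸) - 1‖ ≤ αU j)
        (εU : ℕ → ℝ) (_hεU : ∀ j, 0 ≤ εU j) (_hε1 : ∀ j, εU j ≤ 1) (_hUε : ∀ (j : ℕ) (b : Bond d (towerP L m (j + 1))), ‖(UlevOf L m (n + 1) U j b : 𝔸) - 1‖ ≤ εU j)
        (_hLb : ∀ (j : ℕ) (b : Bond d (towerP L m (j + 1))), UlevOf L m (n + 1) U j b ∈ U1 𝔸)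
        (α : ℝ) (_hα : 0 ≤ α) (_hαle : α ≤ α₁)
        (hUst : ∀ b, star (U b : 𝔸) = (((U b)⁻¹ : 𝔸ˣ) : 𝔸)) (_hUb : ∀ b, U b ∈ U1 𝔸) (_hUη : ∀ b, ‖(U b : 𝔸) - 1‖ ≤ α * η)
        (_hUw : ∀ (x : TSite d (towerP L m (n + 1))) (μ ν : Fin d), ‖(U (shift ν x, μ) : 𝔸) - (U (x, μ) : 𝔸)‖ ≤ α * η ^ 2)
        (_hpl : ∀ p : B9SectCLatticeCarrier.Plaq d (towerP L m (n + 1)), ‖(plaqHolU U p : 𝔸) - 1‖ ≤ α * η ^ 2)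
        (_hUgrad : ∀ (x : TSite d (towerP L m (n + 1))) (μ : Fin d), ‖(U (x, μ) : 𝔸) - U (unshift μ x, μ)‖ ≤ α * η ^ 2)
        (_hRlev : ∀ (j : ℕ) (b : Bond d (towerP L m (j + 1))) (w : W), ‖adTransportW φ (UlevOf L m (n + 1) U j) b w‖ ≤ ‖w‖)
        (_hεg : ∀ j < n + 1, εU j ≤ α * ϱ ^ j) (_hAQ : ∑ j ∈ Finset.range (n + 1), αU j ≤ AQ)
        (hpos' : ∀ x : SiteL2K ℂ d (towerP L m (n + 1)) c₀ W, x ≠ 0 → 0 < RCLike.re ⟪x, laplacePrimeAk L m n φ η U a' (c₁ := c₁) x⟫_ℂ)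
        (hpos : ∀ x : BondL2K ℂ d (towerP L m (n + 1)) c₀ W, x ≠ 0 →
          0 < RCLike.re ⟪x, laplaceAk L m n φ η U hL αU hα1 hU1 hreg τ (c₀ := c₀) (c₁ := c₁) a x⟫_ℂ)
        (_hc₀η : c₀ = η ^ d) (j₀ : ℝ) (_hJ : ∀ μ y, ‖B9Eq39Adjoint.J (fun μ => B9Eq33CovDerivVector.shiftEquiv μ) (fun μ y => U (y, μ)) η μ y‖ ≤ j₀) (_hj : j₀ ≤ j₁)
        (hposπ : ∀ x : BondL2K ℂ d (towerP L m (n + 1)) c₀ W, x ≠ 0 →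
          0 < RCLike.re ⟪x, laplaceAkPi L m n φ τ η U a' hpos' hL αU hα1 hU1 hreg (c₁ := c₁) a x⟫_ℂ)
        (hQ : Function.Surjective (QkW L m n φ U hL αU hα1 hU1 hreg (c₀ := c₀) (c₁ := c₁)))
        (hpos'₁ : ∀ x : SiteL2K ℂ d (towerP L m (n + 1)) c₀ W, x ≠ 0 →
          0 < RCLike.re ⟪x, laplacePrimeAk L m n φ η (fun _ : Bond d (towerP L m (n + 1)) => (1 : 𝔸ˣ)) a' (c₁ := c₁) x⟫_ℂ)
        (hpos₁ : ∀ x : BondL2K ℂ d (towerP L m (n + 1)) c₀ W, x ≠ 0 →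
          0 < RCLike.re ⟪x, laplaceAk L m n φ η (fun _ : Bond d (towerP L m (n + 1)) => (1 : 𝔸ˣ)) hL (fun _ => 0) (fun _ => by norm_num)
            (perCfg_UlevOf_one_mem_U1 L m (n + 1)) (norm_Wcx_UlevOf_one_sub_one_le L m (n + 1) (fun _ => 0) (fun _ => le_rfl)) τ
            (c₀ := c₀) (c₁ := c₁) a x⟫_ℂ)
        (hQ1 : Function.Surjective (QkW L m n φ (fun _ : Bond d (towerP L m (n + 1)) => (1 : 𝔸ˣ)) hL (fun _ => 0) (fun _ => by norm_num)
          (perCfg_UlevOf_one_mem_U1 L m (n + 1)) (norm_Wcx_UlevOf_one_sub_one_le L m (n + 1) (fun _ => 0) (fun _ => le_rfl)) (c₀ := c₀) (c₁ := c₁)))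
        (v : TSite d m) (f : BondL2K ℂ d (towerP L m (n + 1)) c₀ W) (F : ℝ)
        (_hfv : ∀ b', blockCoord (L ^ (n + 1)) m (siteCast (towerP_eq_fineP_pow L m (n + 1)) (bpos b')) ≠ v → WL2.equiv ℂ (fun _ : Bond d (towerP L m (n + 1)) => c₀) W f b' = 0)
        (_hfF : ∀ b', ‖WL2.equiv ℂ (fun _ : Bond d (towerP L m (n + 1)) => c₀) W f b'‖ ≤ F) (bd : Bond d (towerP L m (n + 1))),
        ‖WL2.equiv ℂ (fun _ : Bond d (towerP L m (n + 1)) => c₀) W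
            (frakGLatticeK hposπ hQ f -
              frakGLatticeK (c := ((η : ℂ))⁻¹) (R := adTransportW φ (fun _ : Bond d (towerP L m (n + 1)) => (1 : 𝔸ˣ)))
                (S := adTransportW φ fun _ : Bond d (towerP L m (n + 1)) => (1 : 𝔸ˣ)⁻¹) (Δ₁ := hessOp φ η (fun _ : Bond d (towerP L m (n + 1)) => (1 : 𝔸ˣ)) τ)
                (Rr := RofUk L m n φ η (fun _ : Bond d (towerP L m (n + 1)) => (1 : 𝔸ˣ)))
                (Q := (QkW L m n φ (fun _ : Bond d (towerP L m (n + 1)) => (1 : 𝔸ˣ)) hL (fun _ => 0) (fun _ => by norm_num)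
                  (perCfg_UlevOf_one_mem_U1 L m (n + 1)) (norm_Wcx_UlevOf_one_sub_one_le L m (n + 1) (fun _ => 0) (fun _ => le_rfl)) (c₀ := c₀) (c₁ := c₁))) (a := a)
                hpos₁ hQ1 f) bd‖ ≤
          (j₀ + α) * K * Real.exp (-(κ * tdist m (blockCoord (L ^ (n + 1)) m (siteCast (towerP_eq_fineP_pow L m (n + 1)) (bpos bd))) v)) * F := by
  classical
  obtain ⟨αP, jP, KP, κP, hαP, hjP, hKP, hκP, HP⟩ :=
    exists_letters_G1kPi_sub_flat hd L hL hL3 φ hMφ hMφ' hφ hφ' hstar ha ha' hϱ0 hϱ1 τ hτ hCτ hτm hMτ hρw hτ₁ hτ₂ hφτ AQ b hM₂ hrepr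
  obtain ⟨αM, jM, KM, κM, hαM, hjM, hKM, hκM, HM⟩ :=
    exists_letter_middleWordPi_sub_flat hd L hL hL3 φ hMφ hMφ' hφ hφ' hstar ha ha' hϱ0 hϱ1 τ hτ hCτ hτm hMτ hρw hτ₁ hτ₂ hφτ AQ b hM₂ hrepr
  obtain ⟨αT, jT, KT, κT, hαT, hjT, hKT, hκT, HT⟩ :=
    exists_letter_thirdWordPi_sub_flat hd L hL hL3 φ hMφ hMφ' hφ hφ' hstar ha ha' hϱ0 hϱ1 τ hτ hCτ hτm hMτ hρw hτ₁ hτ₂ hφτ AQ b hM₂ hrepr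
  set κ₀ : ℝ := min κP (min κM κT) with hκ₀
  have hκ₀0 : 0 < κ₀ := lt_min hκP (lt_min hκM hκT)
  have hκ₀P : κ₀ ≤ κP := min_le_left _ _
  have hκ₀M : κ₀ ≤ κM := (min_le_right _ _).trans (min_le_left _ _)
  have hκ₀T : κ₀ ≤ κT := (min_le_right _ _).trans (min_le_right _ _)
  refine ⟨min αP (min αM αT), min jP (min jM jT), KP + KM + KT, κ₀, lt_min hαP (lt_min hαM hαT), lt_min hjP (lt_min hjM hjT), by positivity, hκ₀0, ?_⟩
  intro n η hηL c₀ c₁ _ _ hw hρ m _ hm U αU hα0 hα1 hαL hU1 hreg εU hεU hε1 hUε hLb α hα hαle hUst hUb hUη hUw hpl hUgrad hRlev hεg hAQ hpos' hpos hc₀η j₀ hJ hj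
    hposπ hQ hpos'₁ hpos₁ hQ1 v f F hfv hfF bd
  have hαP' : α ≤ αP := hαle.trans (min_le_left _ _)
  have hαM' : α ≤ αM := hαle.trans ((min_le_right _ _).trans (min_le_left _ _))
  have hαT' : α ≤ αT := hαle.trans ((min_le_right _ _).trans (min_le_right _ _))
  have hjP' : j₀ ≤ jP := hj.trans (min_le_left _ _)
  have hjM' : j₀ ≤ jM := hj.trans ((min_le_right _ _).trans (min_le_left _ _))
  have hjT' : j₀ ≤ jT := hj.trans ((min_le_right _ _).trans (min_le_right _ _))
  have hF : 0 ≤ F := (norm_nonneg _).trans (hfF bd)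
  have hj₀ : 0 ≤ j₀ := (norm_nonneg _).trans (hJ ⟨0, hd⟩ fun _ => 0)
  set D : ℝ := tdist m (blockCoord (L ^ (n + 1)) m (siteCast (towerP_eq_fineP_pow L m (n + 1)) (bpos bd))) v with hD
  have hD0 : 0 ≤ D := tdist_nonneg _ _ _
  have hweak : ∀ {r' : ℝ}, κ₀ ≤ r' → Real.exp (-(r' * D)) ≤ Real.exp (-(κ₀ * D)) := fun hr => Real.exp_le_exp.mpr (by nlinarith)
  -- the three two-background words (first ∕ middle ∕ third), at the common rate
  have h1 := ((HP n η hηL c₀ c₁ hw hρ m hm U αU hα0 hα1 hαL hU1 hreg εU hεU hε1 hUε hLb α hα hαP' hUst hUb hUη hUw hpl hUgrad hRlev hεg hAQ hpos' hpos hc₀η j₀ hJ hjP'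
      hposπ hQ hpos'₁ hpos₁ v f F hfv hfF ⟨0, hd⟩ bd).1).trans (mul_le_mul_of_nonneg_right (mul_le_mul_of_nonneg_left (hweak hκ₀P) (mul_nonneg (add_nonneg hj₀ hα) hKP)) hF)
  have h2 := (HM n η hηL c₀ c₁ hw hρ m hm U αU hα0 hα1 hαL hU1 hreg εU hεU hε1 hUε hLb α hα hαM' hUst hUb hUη hUw hpl hUgrad hRlev hεg hAQ hpos' hpos hc₀η j₀ hJ hjM'
      hposπ hQ hpos'₁ hpos₁ v f F hfv hfF bd).trans (mul_le_mul_of_nonneg_right (mul_le_mul_of_nonneg_left (hweak hκ₀M) (mul_nonneg (add_nonneg hj₀ hα) hKM)) hF)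
  have h3 := (HT n η hηL c₀ c₁ hw hρ m hm U αU hα0 hα1 hαL hU1 hreg εU hεU hε1 hUε hLb α hα hαT' hUst hUb hUη hUw hpl hUgrad hRlev hεg hAQ hpos' hpos hc₀η j₀ hJ hjT'
      hposπ hQ hpos'₁ hpos₁ v f F hfv hfF bd).trans (mul_le_mul_of_nonneg_right (mul_le_mul_of_nonneg_left (hweak hκ₀T) (mul_nonneg (add_nonneg hj₀ hα) hKT)) hF)
  -- `𝔊̃_k(U)f` and `𝔊_k(1)f` unfolded ((3.153); the middle word is `H₁ = G₁Q*(QG₁Q*)⁻¹` of (3.126), `H1LatticeK_eq`), and the difference regrouped word by word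
  have key : ∀ a₁ a₂ a₃ b₁ b₂ b₃ : BondL2K ℂ d (towerP L m (n + 1)) c₀ W,
      WL2.equiv ℂ (fun _ : Bond d (towerP L m (n + 1)) => c₀) W ((a₁ - a₂ - a₃) - (b₁ - b₂ - b₃)) bd =
        (WL2.equiv ℂ (fun _ : Bond d (towerP L m (n + 1)) => c₀) W (a₁ - b₁) bd - WL2.equiv ℂ (fun _ : Bond d (towerP L m (n + 1)) => c₀) W (a₂ - b₂) bd) -
          WL2.equiv ℂ (fun _ : Bond d (towerP L m (n + 1)) => c₀) W (a₃ - b₃) bd := by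
    intro a₁ a₂ a₃ b₁ b₂ b₃
    simp only [WL2.equiv_sub, Pi.sub_apply]
    abel
  unfold frakGLatticeK
  rw [frakGLin_apply, frakGLin_apply, key]
  refine (norm_sub_le _ _).trans ((add_le_add ((norm_sub_le _ _).trans (add_le_add h1 h2)) h3).trans (le_of_eq ?_))
  ring

/-! ## §2 The global sup row of `𝔊̃_k(U) − 𝔊_k(1)`, value member -/

include hd hL hL3 hMφ hMφ' hφ hφ' hstar ha ha' hϱ0 hϱ1 hτ hCτ hτm hMτ hρw hτ₁ hτ₂ hφτ hM₂ hrepr in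
set_option maxHeartbeats 3200000 in
set_option maxRecDepth 8192 in
/-- **THE `𝔊̃_k` STOREY, VALUE MEMBER, GLOBAL FORM** — for every fine-bond field `g` with `‖g(b′)‖ ≤ M`: `‖((𝔊̃_k(U) − 𝔊_k(1))g)(b)‖ ≤ (j₀ + α)·K·M`, constants before the lattice (the block
decomposition of `g` over the coarse base points and the row sum `Σ_v e^{−κ d(Π(b₋), v)} ≤ K_d(κ)`). [folklore]
[cite: Balaban1985BackgroundPropagators, (3.153) p.426, (3.122) p.420, Thm 3.4 p.400, Thm 3.13 p.426, (3.47) p.398; Balaban1985Variational, (110)–(111) p.294, (117) p.295] -/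
theorem exists_supRow_frakGkPi_sub_flat :
    ∃ α₁ j₁ K : ℝ, 0 < α₁ ∧ 0 < j₁ ∧ 0 ≤ K ∧
      ∀ (n : ℕ) (η : ℝ) (_hηL : η * (L : ℝ) ^ (n + 1) = 1) (c₀ c₁ : ℝ) [Fact (0 < c₀)] [Fact (0 < c₁)]
        (_hw : c₀ * ((L : ℝ) ^ (n + 1)) ^ d = c₁) (_hρ : |η| ^ d / c₀ ≤ ρw) (m : Fin d → ℕ) [∀ i, NeZero (m i)] (_hm : ∀ i, 1 ≤ m i)
        (U : Bond d (towerP L m (n + 1)) → 𝔸ˣ) (αU : ℕ → ℝ) (_hα0 : ∀ j, 0 ≤ αU j) (hα1 : ∀ j, αU j ≤ 1 / 64)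
        (_hαL : ∀ j, 50 * (d + 1) * αU j * (L : ℝ) ^ d ≤ 1 / 2)
        (hU1 : ∀ (j : ℕ) (x : B7Prop1Explicit.Site d) (k : Fin d), perCfg (towerP L m (j + 1)) (UlevOf L m (n + 1) U j) x k ∈ U1 𝔸)
        (hreg : ∀ (j : ℕ) (y : TSite d (towerP L m j)) (k : Fin d) (ρ' : Fin d → Fin L),
          ‖((Wcx L (perCfg (towerP L m (j + 1)) (UlevOf L m (n + 1) U j)) (cornerSite L y) k (boxVec L ρ') : 𝔸ˣ) : 𝔸) - 1‖ ≤ αU j)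
        (εU : ℕ → ℝ) (_hεU : ∀ j, 0 ≤ εU j) (_hε1 : ∀ j, εU j ≤ 1) (_hUε : ∀ (j : ℕ) (b : Bond d (towerP L m (j + 1))), ‖(UlevOf L m (n + 1) U j b : 𝔸) - 1‖ ≤ εU j)
        (_hLb : ∀ (j : ℕ) (b : Bond d (towerP L m (j + 1))), UlevOf L m (n + 1) U j b ∈ U1 𝔸)
        (α : ℝ) (_hα : 0 ≤ α) (_hαle : α ≤ α₁)
        (hUst : ∀ b, star (U b : 𝔸) = (((U b)⁻¹ : 𝔸ˣ) : 𝔸)) (_hUb : ∀ b, U b ∈ U1 𝔸) (_hUη : ∀ b, ‖(U b : 𝔸) - 1‖ ≤ α * η)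
        (_hUw : ∀ (x : TSite d (towerP L m (n + 1))) (μ ν : Fin d), ‖(U (shift ν x, μ) : 𝔸) - (U (x, μ) : 𝔸)‖ ≤ α * η ^ 2)
        (_hpl : ∀ p : B9SectCLatticeCarrier.Plaq d (towerP L m (n + 1)), ‖(plaqHolU U p : 𝔸) - 1‖ ≤ α * η ^ 2)
        (_hUgrad : ∀ (x : TSite d (towerP L m (n + 1))) (μ : Fin d), ‖(U (x, μ) : 𝔸) - U (unshift μ x, μ)‖ ≤ α * η ^ 2)
        (_hRlev : ∀ (j : ℕ) (b : Bond d (towerP L m (j + 1))) (w : W), ‖adTransportW φ (UlevOf L m (n + 1) U j) b w‖ ≤ ‖w‖)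
        (_hεg : ∀ j < n + 1, εU j ≤ α * ϱ ^ j) (_hAQ : ∑ j ∈ Finset.range (n + 1), αU j ≤ AQ)
        (hpos' : ∀ x : SiteL2K ℂ d (towerP L m (n + 1)) c₀ W, x ≠ 0 → 0 < RCLike.re ⟪x, laplacePrimeAk L m n φ η U a' (c₁ := c₁) x⟫_ℂ)
        (hpos : ∀ x : BondL2K ℂ d (towerP L m (n + 1)) c₀ W, x ≠ 0 →
          0 < RCLike.re ⟪x, laplaceAk L m n φ η U hL αU hα1 hU1 hreg τ (c₀ := c₀) (c₁ := c₁) a x⟫_ℂ)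
        (_hc₀η : c₀ = η ^ d) (j₀ : ℝ) (_hJ : ∀ μ y, ‖B9Eq39Adjoint.J (fun μ => B9Eq33CovDerivVector.shiftEquiv μ) (fun μ y => U (y, μ)) η μ y‖ ≤ j₀) (_hj : j₀ ≤ j₁)
        (hposπ : ∀ x : BondL2K ℂ d (towerP L m (n + 1)) c₀ W, x ≠ 0 →
          0 < RCLike.re ⟪x, laplaceAkPi L m n φ τ η U a' hpos' hL αU hα1 hU1 hreg (c₁ := c₁) a x⟫_ℂ)
        (hQ : Function.Surjective (QkW L m n φ U hL αU hα1 hU1 hreg (c₀ := c₀) (c₁ := c₁)))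
        (hpos'₁ : ∀ x : SiteL2K ℂ d (towerP L m (n + 1)) c₀ W, x ≠ 0 →
          0 < RCLike.re ⟪x, laplacePrimeAk L m n φ η (fun _ : Bond d (towerP L m (n + 1)) => (1 : 𝔸ˣ)) a' (c₁ := c₁) x⟫_ℂ)
        (hpos₁ : ∀ x : BondL2K ℂ d (towerP L m (n + 1)) c₀ W, x ≠ 0 →
          0 < RCLike.re ⟪x, laplaceAk L m n φ η (fun _ : Bond d (towerP L m (n + 1)) => (1 : 𝔸ˣ)) hL (fun _ => 0) (fun _ => by norm_num)
            (perCfg_UlevOf_one_mem_U1 L m (n + 1)) (norm_Wcx_UlevOf_one_sub_one_le L m (n + 1) (fun _ => 0) (fun _ => le_rfl)) τ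
            (c₀ := c₀) (c₁ := c₁) a x⟫_ℂ)
        (hQ1 : Function.Surjective (QkW L m n φ (fun _ : Bond d (towerP L m (n + 1)) => (1 : 𝔸ˣ)) hL (fun _ => 0) (fun _ => by norm_num)
          (perCfg_UlevOf_one_mem_U1 L m (n + 1)) (norm_Wcx_UlevOf_one_sub_one_le L m (n + 1) (fun _ => 0) (fun _ => le_rfl)) (c₀ := c₀) (c₁ := c₁)))
        (g : BondL2K ℂ d (towerP L m (n + 1)) c₀ W) (M : ℝ) (_hM : 0 ≤ M)
        (_hgM : ∀ b', ‖WL2.equiv ℂ (fun _ : Bond d (towerP L m (n + 1)) => c₀) W g b'‖ ≤ M) (bd : Bond d (towerP L m (n + 1))),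
        ‖WL2.equiv ℂ (fun _ : Bond d (towerP L m (n + 1)) => c₀) W
            ((frakGLatticeK hposπ hQ -
              frakGLatticeK (c := ((η : ℂ))⁻¹) (R := adTransportW φ (fun _ : Bond d (towerP L m (n + 1)) => (1 : 𝔸ˣ)))
                (S := adTransportW φ fun _ : Bond d (towerP L m (n + 1)) => (1 : 𝔸ˣ)⁻¹) (Δ₁ := hessOp φ η (fun _ : Bond d (towerP L m (n + 1)) => (1 : 𝔸ˣ)) τ)
                (Rr := RofUk L m n φ η (fun _ : Bond d (towerP L m (n + 1)) => (1 : 𝔸ˣ)))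
                (Q := (QkW L m n φ (fun _ : Bond d (towerP L m (n + 1)) => (1 : 𝔸ˣ)) hL (fun _ => 0) (fun _ => by norm_num)
                  (perCfg_UlevOf_one_mem_U1 L m (n + 1)) (norm_Wcx_UlevOf_one_sub_one_le L m (n + 1) (fun _ => 0) (fun _ => le_rfl)) (c₀ := c₀) (c₁ := c₁))) (a := a)
                hpos₁ hQ1) g) bd‖ ≤ (j₀ + α) * K * M := by
  classical
  obtain ⟨αV, jV, KV, κV, hαV, hjV, hKV, hκV, HV⟩ :=
    exists_letter_frakGkPi_sub_flat hd L hL hL3 φ hMφ hMφ' hφ hφ' hstar ha ha' hϱ0 hϱ1 τ hτ hCτ hτm hMτ hρw hτ₁ hτ₂ hφτ AQ b hM₂ hrepr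
  set SV : ℝ := latticeConst d κV with hSV
  have hSV0 : 0 ≤ SV := latticeConst_nonneg d hκV.le
  refine ⟨αV, jV, KV * SV, hαV, hjV, by positivity, ?_⟩
  intro n η hηL c₀ c₁ _ _ hw hρ m _ hm U αU hα0 hα1 hαL hU1 hreg εU hεU hε1 hUε hLb α hα hαle hUst hUb hUη hUw hpl hUgrad hRlev hεg hAQ hpos' hpos hc₀η j₀ hJ hj
    hposπ hQ hpos'₁ hpos₁ hQ1 g M hM hgM bd
  have hj₀ : 0 ≤ j₀ := (norm_nonneg _).trans (hJ ⟨0, hd⟩ fun _ => 0)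
  -- names
  set piB : Bond d (towerP L m (n + 1)) → TSite d m := fun b' => blockCoord (L ^ (n + 1)) m (siteCast (towerP_eq_fineP_pow L m (n + 1)) (bpos b')) with hpiB
  set FU := frakGLatticeK hposπ hQ with hFU
  set F1 := frakGLatticeK (c := ((η : ℂ))⁻¹) (R := adTransportW φ (fun _ : Bond d (towerP L m (n + 1)) => (1 : 𝔸ˣ)))
                (S := adTransportW φ fun _ : Bond d (towerP L m (n + 1)) => (1 : 𝔸ˣ)⁻¹) (Δ₁ := hessOp φ η (fun _ : Bond d (towerP L m (n + 1)) => (1 : 𝔸ˣ)) τ)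
                (Rr := RofUk L m n φ η (fun _ : Bond d (towerP L m (n + 1)) => (1 : 𝔸ˣ)))
                (Q := (QkW L m n φ (fun _ : Bond d (towerP L m (n + 1)) => (1 : 𝔸ˣ)) hL (fun _ => 0) (fun _ => by norm_num)
                  (perCfg_UlevOf_one_mem_U1 L m (n + 1)) (norm_Wcx_UlevOf_one_sub_one_le L m (n + 1) (fun _ => 0) (fun _ => le_rfl)) (c₀ := c₀) (c₁ := c₁))) (a := a)
                hpos₁ hQ1 with hF1
  -- the block decomposition of the source over the coarse base points
  obtain ⟨P, hP⟩ := exists_block_clm_family (𝕜 := ℂ) (w := fun _ : Bond d (towerP L m (n + 1)) => c₀) (V := W) piB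
  have hdec : (FU - F1) g = ∑ v, (FU (P v g) - F1 (P v g)) := by
    conv_lhs => rw [← sum_block_apply hP g]
    rw [LinearMap.sub_apply, map_sum, map_sum, Finset.sum_sub_distrib]
  have hfun : WL2.equiv ℂ (fun _ : Bond d (towerP L m (n + 1)) => c₀) W ((FU - F1) g) =
      ∑ v, WL2.equiv ℂ (fun _ : Bond d (towerP L m (n + 1)) => c₀) W (FU (P v g) - F1 (P v g)) := by
    rw [hdec]
    have e := map_sum (WL2.linearEquiv ℂ ℂ (fun _ : Bond d (towerP L m (n + 1)) => c₀) (V := W)) (fun v => FU (P v g) - F1 (P v g)) Finset.univ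
    simpa only [WL2.linearEquiv_apply] using e
  have hblk : ∀ v, (∀ b', piB b' ≠ v → WL2.equiv ℂ (fun _ : Bond d (towerP L m (n + 1)) => c₀) W (P v g) b' = 0) ∧
      (∀ b', ‖WL2.equiv ℂ (fun _ : Bond d (towerP L m (n + 1)) => c₀) W (P v g) b'‖ ≤ M) := by
    intro v
    refine ⟨fun b' hb' => ?_, fun b' => ?_⟩
    · rw [hP, if_neg hb']
    · rw [hP]
      split_ifs
      · exact hgM b'
      · rw [norm_zero]; exact hM
  rw [hfun, Finset.sum_apply]
  calc ‖∑ v, WL2.equiv ℂ (fun _ : Bond d (towerP L m (n + 1)) => c₀) W (FU (P v g) - F1 (P v g)) bd‖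
      ≤ ∑ v, ‖WL2.equiv ℂ (fun _ : Bond d (towerP L m (n + 1)) => c₀) W (FU (P v g) - F1 (P v g)) bd‖ := norm_sum_le _ _
    _ ≤ ∑ v, (j₀ + α) * KV * Real.exp (-(κV * tdist m (piB bd) v)) * M := Finset.sum_le_sum fun v _ =>
        HV n η hηL c₀ c₁ hw hρ m hm U αU hα0 hα1 hαL hU1 hreg εU hεU hε1 hUε hLb α hα hαle hUst hUb hUη hUw hpl hUgrad hRlev hεg hAQ hpos' hpos hc₀η j₀ hJ hj
          hposπ hQ hpos'₁ hpos₁ hQ1 v (P v g) M (hblk v).1 (hblk v).2 bd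
    _ = (j₀ + α) * KV * M * ∑ v, Real.exp (-(κV * tdist m (piB bd) v)) := by
        rw [Finset.mul_sum]; exact Finset.sum_congr rfl fun v _ => by ring
    _ ≤ (j₀ + α) * KV * M * SV := mul_le_mul_of_nonneg_left (torusSum_le d hm hκV (piB bd)) (by positivity)
    _ = (j₀ + α) * (KV * SV) * M := by ring

end Literature.MathematicalPhysics.QuantumFieldTheory.Balaban1983to89.B9Eq3153FrakGkPiTwoBackgroundLetterTower

end
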